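import Summits.QuantumFields.BalabanUV.Beta.AxialDressingRootedBmLinear
import Summits.QuantumFields.BalabanUV.Beta.AxialDressingRootedBmHessian
import Summits.QuantumFields.BalabanUV.Beta.RelInvBorderedHessian
import Summits.QuantumFields.BalabanUV.Beta.D1BFx.NlegKHessSplit
import Literature.MathematicalPhysics.QuantumFieldTheory.Balaban1983to89.Beta.SecondOrderResponse

/-!
# `BalabanUV.Beta.D1BFx.PackedDressingBridge` — road «BF-x» for binder row D1, slot (K), chain step (I): brick «PACK-BRIDGE» — **THE ROAD's PACK
# `G₀ := coDressKBmAt (toSite r) n (KInvStep n 0)` (the torus comb-gauged KKT inverse's `ℋ`-block, (B4b)) MEETS THE `wH`-PACK OF THE END (`vertexOf`,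
# `vertexRedF`, `NlegRoad`'s `ℋ_R`-column) AT THE Πᵀ_bm-DRESSED STENCILS**: `vertexOfK G₀ n S = vertexOf (coProjBmAtK (toSite r) n S)
# = vertexOfK (NlegRoad m a) n (coProjBmAtK (toSite r) n S)` (the last step mod [B5] Prop. 1.2 ∧ (1.126)–(1.127) BY NAME), and the bi-vertex ∕ scalar-family
# analogues — the junction lines between PART 3b `PackedLiteralCombine.hessKer_transfer_road_cov_packed_literal` (G₀-packed M∕N∕ghost∕comb families) and the
# `wH`-packed rows of the (II) lanes (leaf-01 `RestKernelSandwichUnit`, leaf-04 `RestJetBlockMass`) ∕ the END's ghost ray (`GhostKernelComplete.PghQ`).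

HONEST DEPENDENCY (cell records, verbatim): «continuum YM on T⁴ ⇐ BetaPertH ∧ nine spine estimates (0/9 proved); BetaPertH ⇐ (D1) ∧ (D4) ∧
CAP+tail; G-an2-4 gates asym, D1 and NE2/3/4.»  HONEST FRAMING (cell contract, verbatim): «discharging `BetaPertH` makes Bałaban's UV stability
UNCONDITIONAL — a real constructive-QFT result; it is NOT the continuum limit and NOT the Clay problem.»  THIS MODULE DISCHARGES NOTHING of (K),
of D1 or of the wall: [folklore] `ℓ¹` bookkeeping BY NAME of an5∕an2's `AxialDressingRootedBmLinear.sum_tsum_mul_coProjBmAt` ∕ `colH_coDressKBmAt_eq`,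
`BorderedHessian.KInvStep_zero_eq`, `OneStepKernelFamily.vertexOfK_KInv`, and `NlegKHessSplit.vertexOfK_NlegRoad_eq_vertexOf` (the latter modulo the road's
standing `h12 ∧ h126`).  No definition, no `def … : Prop`, nothing cited, 0 sorry.  0 root-level binders of row D1 discharged; (K) NOT closed; NOT D1,
NOT `BetaPertH`, NOT continuum, NOT Clay.

ABSOLUTE RULE (cell charter, verbatim): «No internally-minted statement may enter as a cited fact. Every hypothesis is either kernel-proved in this
package or a verbatim quotation of a PUBLISHED theorem with page reference. The manuscript(s) under audit are NOT citable for their own disputed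
steps — they are the thing under adjudication; programme-internal (2001/route/tribunal) claims are never citable.»

CONTENT (all [folklore]; `ρ := toSite r`, `r ∈ box (d+1) N` an in-block root).
* §1 **`vertexOfK_coDressKBmAt_eq`**: for a decaying `K` and ANY entrywise-bounded bond family `S`, `vertexOfK (coDressKBmAt ρ N K) N S = vertexOfK K N (coProjBmAtK ρ N S)`
  — packing the UNDRESSED stencils with the co-dressed kernel's `ℋ`-columns IS packing the Πᵀ_bm-DRESSED stencils with `K`'s own columns.
* §2 **`vertex2OfK_coDressKBmAt_eq`**: the bi-vertex analogue (§1 twice; the inner vertex family is bounded by `SecondOrderResponse.biLoc_vertexOfK_slice`).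
* §3 ROAD INSTANCES at `G₀ := coDressKBmAt (toSite r) N (KInvStep N 0)`: **`vertexOfK_G₀_eq_vertexOf`** (`= vertexOf (coProjBmAtK (toSite r) N S)`), and in `d = 3`, mod `h12 ∧ h126`,
  **`vertexOfK_G₀_eq_vertexOfK_NlegRoad`** (`= vertexOfK (NlegRoad m a) (m+1) (coProjBmAtK (toSite r) (m+1) S)`).
* §5 (v1.1) `abs_le_of_locStencil₂`, **`coProjBmAtK_vertexOfK_comm`** (Πᵀ_bm on the OUTER index commutes with the inner vertex), **`vertex2OfK_coDressKBmAt_eq_full`**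
  (`vertex2OfK (coDressKBmAt ρ N K) N S₂ = vertex2OfK K N S₂^{ΠΠ}`, both bond indices dressed).
* §4 **`sum_wsum_colH_coDressKBmAt`**: the same transfer for the SCALAR-weighted words of (B6′) (ghost ∕ comb-FP families on ANY fibre):
  `Σ_κ wsum (colH (coDressKBmAt ρ N K) N μ y κ) (F κ) = Σ_κ wsum (colH K N μ y κ) (u ↦ Πᵀ_bm F κ u)` entrywise.
Unit `b2b-balaban-beta-d1-p2` (road owner, gen 18), 2026-08-22.
-/

noncomputable section

namespace Summit.QuantumFields.BalabanUV.Beta.D1BFx.PackedDressingBridge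

open scoped BigOperators
open Literature.MathematicalPhysics.QuantumFieldTheory.Balaban1983to89
open Literature.MathematicalPhysics.QuantumFieldTheory.Balaban1983to89.Beta
open B12Sec2to5 (l1 l1_nonneg)
open ExpKernelCalculus (MKer BiLoc Decays Zl Zl_nonneg)
open AffineAveraging (box toSite)
open OneStepResolventKernel (Fib wsum KInv vertexOf LocStencil)
open OneStepKernelFamily (KInvStep colH vertexOfK vertexOfK_KInv decays_KInvStep)
open BalabanCompositeJets (LocStencil₂)
open SecondOrderResponse (vertex2OfK biLoc_vertexOfK_slice)
open VectorTailsLoc (fam kfam)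
open Summit.QuantumFields.BalabanUV.Beta.TameKernelCalculus (decays_of_le)
open Summit.QuantumFields.BalabanUV.Beta.AxialDressingRooted (coDressKBmAt coProjBmAt coProjBmAtK coProjBmW decays_coDressKBmAt colH_coDressKBmAt_eq
  sum_tsum_mul_coProjBmAt one_le_of_neZero)
open Summit.QuantumFields.BalabanUV.Beta.BorderedHessian (KInvStep_zero_eq)
open Summit.QuantumFields.BalabanUV.Beta.D1BFx.FrozenLegTails (nOf MOf hn1)
open Summit.QuantumFields.BalabanUV.Beta.D1BFx.RWeightedLegPack (NlegRoad)
open Summit.QuantumFields.BalabanUV.Beta.D1BFx.NlegKHessSplit (vertexOfK_NlegRoad_eq_vertexOf)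

variable {d : ℕ}

/-! ## §1 The chain-rule vertex: co-dressed kernel ∕ undressed stencils = kernel ∕ dressed stencils -/

section First

variable {N : ℕ} (hN : 1 ≤ N) {r : Fin (d + 1) → ℕ} (hr : r ∈ box (d + 1) N)
include hN hr

/-- [folklore] **PACK BRIDGE, FIRST ORDER.**  For a decaying kernel `K` and any bond family `S` with entrywise-bounded members,
`vertexOfK (coDressKBmAt (toSite r) N K) N S μ y = vertexOfK K N (coProjBmAtK (toSite r) N S) μ y`: the chain-rule vertex of the UNDRESSED stencils through the
`ℋ`-columns of the CO-DRESSED kernel (`colH (coDressKBmAt ρ N K) = coProjBmW ρ N ∘ colH K`) IS the chain-rule vertex through `K`'s own columns of the Πᵀ_bm-DRESSED stencils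
(`sum_tsum_mul_coProjBmAt`). -/
theorem vertexOfK_coDressKBmAt_eq {K : MKer (d + 1) (Fib d)} {C δ : ℝ} (hK : Decays K C δ) (hδ : 0 < δ)
    (S : Fin (d + 1) → (Fin (d + 1) → ℤ) → MKer (d + 1) (Fib d)) (hSb : ∀ x z a b, ∃ M : ℝ, ∀ κ u, |S κ u x z a b| ≤ M)
    (μ : Fin (d + 1)) (y : Fin (d + 1) → ℤ) :
    vertexOfK (coDressKBmAt (toSite r) N K) N S μ y = vertexOfK K N (coProjBmAtK (toSite r) N S) μ y := by
  funext x z a b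
  obtain ⟨M, hM⟩ := hSb x z a b
  have hA : ∀ κ : Fin (d + 1), Summable (colH K N μ y κ) :=
    fun κ => AxialDressing.summable_col_of_decays hK hδ ((N : ℤ) • y) (Sum.inl κ) (Sum.inr μ)
  have h := sum_tsum_mul_coProjBmAt hN hr hA (g := fun κ u => S κ u x z a b) hM
  simp only [vertexOfK, wsum, coProjBmAtK, colH_coDressKBmAt_eq]
  exact h.symm

omit hN hr in
/-- [folklore] A self-localised stencil family is entrywise bounded by its constant. -/
theorem bdd_of_locStencil {S : Fin (d + 1) → (Fin (d + 1) → ℤ) → MKer (d + 1) (Fib d)} {Cs δs : ℝ} (hS : LocStencil S Cs δs) (hδs : 0 ≤ δs)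
    (x z : Fin (d + 1) → ℤ) (a b : Fib d) : ∃ M : ℝ, ∀ κ u, |S κ u x z a b| ≤ M := by
  refine ⟨Cs, fun κ u => (hS κ u x z a b).trans ?_⟩
  have hCs : 0 ≤ Cs := (hS κ u).nonneg (Sum.inl 0)
  have he : Real.exp (-δs * (l1 (x - u) + l1 (z - u))) ≤ 1 :=
    Real.exp_le_one_iff.2 (by nlinarith [l1_nonneg (x - u), l1_nonneg (z - u)])
  calc Cs * Real.exp (-δs * (l1 (x - u) + l1 (z - u))) ≤ Cs * 1 := mul_le_mul_of_nonneg_left he hCs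
    _ = Cs := mul_one _

omit hN hr in
/-- [folklore] A member of a `LocStencil₂` family, as a bond family in its SECOND index, is entrywise bounded by the constant. -/
theorem bdd_of_locStencil₂ {S₂ : Fin (d + 1) → (Fin (d + 1) → ℤ) → Fin (d + 1) → (Fin (d + 1) → ℤ) → MKer (d + 1) (Fib d)} {C₂ δ₂ : ℝ}
    (hS₂ : LocStencil₂ S₂ C₂ δ₂) (hδ₂ : 0 ≤ δ₂) (κ : Fin (d + 1)) (u x z : Fin (d + 1) → ℤ) (a b : Fib d) :
    ∃ M : ℝ, ∀ κ' u', |S₂ κ u κ' u' x z a b| ≤ M := by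
  refine ⟨C₂, fun κ' u' => (hS₂ κ u κ' u' x z a b).trans ?_⟩
  have hC₂ := hS₂.nonneg
  have h1 : Real.exp (-δ₂ * l1 (u' - u)) ≤ 1 := Real.exp_le_one_iff.2 (by nlinarith [l1_nonneg (u' - u)])
  have h2 : Real.exp (-δ₂ * (l1 (x - u) + l1 (z - u))) ≤ 1 := Real.exp_le_one_iff.2 (by nlinarith [l1_nonneg (x - u), l1_nonneg (z - u)])
  calc C₂ * Real.exp (-δ₂ * l1 (u' - u)) * Real.exp (-δ₂ * (l1 (x - u) + l1 (z - u))) ≤ C₂ * 1 * 1 :=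
        mul_le_mul (mul_le_mul_of_nonneg_left h1 hC₂) h2 (Real.exp_pos _).le (by positivity)
    _ = C₂ := by ring

/-- [folklore] **PACK BRIDGE, FIRST ORDER, `LocStencil` form.** -/
theorem vertexOfK_coDressKBmAt_eq_of_locStencil {K : MKer (d + 1) (Fib d)} {C δ : ℝ} (hK : Decays K C δ) (hδ : 0 < δ)
    {S : Fin (d + 1) → (Fin (d + 1) → ℤ) → MKer (d + 1) (Fib d)} {Cs δs : ℝ} (hS : LocStencil S Cs δs) (hδs : 0 ≤ δs)
    (μ : Fin (d + 1)) (y : Fin (d + 1) → ℤ) :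
    vertexOfK (coDressKBmAt (toSite r) N K) N S μ y = vertexOfK K N (coProjBmAtK (toSite r) N S) μ y :=
  vertexOfK_coDressKBmAt_eq hN hr hK hδ S (bdd_of_locStencil hS hδs) μ y

end First

/-! ## §2 The bi-vertex -/

section Second

variable {N : ℕ} (hN : 1 ≤ N) {r : Fin (d + 1) → ℕ} (hr : r ∈ box (d + 1) N)
include hN hr

/-- [folklore] **PACK BRIDGE, SECOND ORDER.**  For a decaying `K` and a `LocStencil₂` family, the bi-vertex through the co-dressed kernel of the undressed pair stencils
is the bi-vertex through `K` of the TWICE Πᵀ_bm-DRESSED pair stencils, written as §1 applied to the inner and then to the outer slot: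
`vertex2OfK (coDressKBmAt ρ N K) N S₂ μ y ν y′ = vertexOfK K N (coProjBmAtK ρ N (fun κ u => vertexOfK K N (coProjBmAtK ρ N (S₂ κ u)) ν y′)) μ y`. -/
theorem vertex2OfK_coDressKBmAt_eq {K : MKer (d + 1) (Fib d)} {C δ : ℝ} (hK : Decays K C δ) (hC : 0 ≤ C) (hδ : 0 < δ)
    {S₂ : Fin (d + 1) → (Fin (d + 1) → ℤ) → Fin (d + 1) → (Fin (d + 1) → ℤ) → MKer (d + 1) (Fib d)} {C₂ δ₂ : ℝ}
    (hS₂ : LocStencil₂ S₂ C₂ δ₂) (hδ₂ : 0 < δ₂) (μ : Fin (d + 1)) (y : Fin (d + 1) → ℤ) (ν : Fin (d + 1)) (y' : Fin (d + 1) → ℤ) :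
    vertex2OfK (coDressKBmAt (toSite r) N K) N S₂ μ y ν y'
      = vertexOfK K N (coProjBmAtK (toSite r) N (fun κ u => vertexOfK K N (coProjBmAtK (toSite r) N (S₂ κ u)) ν y')) μ y := by
  -- the inner slot, member by member
  have hin : ∀ κ u, vertexOfK (coDressKBmAt (toSite r) N K) N (S₂ κ u) ν y' = vertexOfK K N (coProjBmAtK (toSite r) N (S₂ κ u)) ν y' :=
    fun κ u => vertexOfK_coDressKBmAt_eq hN hr hK hδ (S₂ κ u) (fun x z a b => bdd_of_locStencil₂ hS₂ hδ₂.le κ u x z a b) ν y'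
  have e : (fun κ u => vertexOfK K N (coProjBmAtK (toSite r) N (S₂ κ u)) ν y')
      = fun κ u => vertexOfK (coDressKBmAt (toSite r) N K) N (S₂ κ u) ν y' := funext fun κ => funext fun u => (hin κ u).symm
  unfold vertex2OfK
  rw [e]
  -- the outer slot: the inner vertex family is entrywise bounded (`biLoc_vertexOfK_slice` through the decaying co-dressed kernel)
  refine vertexOfK_coDressKBmAt_eq hN hr hK hδ _ (fun x z a b => ?_) μ y
  obtain ⟨δG, CG, hδG, hCG, hG⟩ := decays_coDressKBmAt hN hr ⟨δ, C, hδ, hC, hK⟩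
  -- common rate for the slice lemma
  have hm : 0 < min δG δ₂ := lt_min hδG hδ₂
  have hG' : Decays (coDressKBmAt (toSite r) N K) (|CG|) (min δG δ₂) := decays_of_le hG (min_le_left _ _)
  have hS₂' : LocStencil₂ S₂ C₂ (min δG δ₂) := fun κ u κ' u' w w' a' b' => by
    refine (hS₂ κ u κ' u' w w' a' b').trans ?_
    have hC₂ := hS₂.nonneg
    rw [mul_assoc, mul_assoc, ← Real.exp_add, ← Real.exp_add]
    refine mul_le_mul_of_nonneg_left (Real.exp_le_exp.2 ?_) hC₂
    have := min_le_right δG δ₂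
    nlinarith [l1_nonneg (u' - u), l1_nonneg (w - u), l1_nonneg (w' - u)]
  refine ⟨(d + 1 : ℕ) * (|CG| * C₂ * Zl (d + 1) (min δG δ₂ / 2)), fun κ u => ?_⟩
  have h := biLoc_vertexOfK_slice (N := N) hG' (abs_nonneg _) hS₂' hm κ u ν y' x z a b
  refine h.trans ?_
  have hZ := Zl_nonneg (D := d + 1) (half_pos hm)
  have hC₂ := hS₂.nonneg
  have h1 : Real.exp (-(min δG δ₂ / 2) * l1 (u - (N : ℤ) • y')) ≤ 1 := Real.exp_le_one_iff.2 (by nlinarith [l1_nonneg (u - (N : ℤ) • y')])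
  have h2 : Real.exp (-(min δG δ₂) * (l1 (x - u) + l1 (z - u))) ≤ 1 := Real.exp_le_one_iff.2 (by nlinarith [l1_nonneg (x - u), l1_nonneg (z - u)])
  calc (d + 1 : ℕ) * (|CG| * C₂ * Zl (d + 1) (min δG δ₂ / 2) * Real.exp (-(min δG δ₂ / 2) * l1 (u - (N : ℤ) • y')))
        * Real.exp (-(min δG δ₂) * (l1 (x - u) + l1 (z - u)))
      ≤ (d + 1 : ℕ) * (|CG| * C₂ * Zl (d + 1) (min δG δ₂ / 2) * 1) * 1 :=
        mul_le_mul (mul_le_mul_of_nonneg_left (mul_le_mul_of_nonneg_left h1 (by positivity)) (by positivity)) h2 (Real.exp_pos _).le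
          (by positivity)
    _ = (d + 1 : ℕ) * (|CG| * C₂ * Zl (d + 1) (min δG δ₂ / 2)) := by ring

end Second

/-! ## §3 The road's pack `G₀` -/

section Road

variable {N : ℕ} [NeZero N] {r : Fin (d + 1) → ℕ} (hr : r ∈ box (d + 1) N)
include hr

/-- [folklore] **THE ROAD's PACK IS THE ONE-SHOT PACK OF THE DRESSED STENCILS**: for every self-localised stencil family `S`,
`vertexOfK G₀ N S μ y = vertexOf (N := N) (coProjBmAtK (toSite r) N S) μ y`, `G₀ := coDressKBmAt (toSite r) N (KInvStep N 0)` (§1 + `KInvStep_zero_eq` + `vertexOfK_KInv`). -/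
theorem vertexOfK_G₀_eq_vertexOf {S : Fin (d + 1) → (Fin (d + 1) → ℤ) → MKer (d + 1) (Fib d)} {Cs δs : ℝ} (hS : LocStencil S Cs δs) (hδs : 0 ≤ δs)
    (μ : Fin (d + 1)) (y : Fin (d + 1) → ℤ) :
    vertexOfK (coDressKBmAt (toSite r) N (KInvStep (d := d) N 0)) N S μ y = vertexOf (N := N) (coProjBmAtK (toSite r) N S) μ y := by
  obtain ⟨δ, C, hδ, -, hK⟩ := decays_KInvStep (d := d) (Lc := N) 0
  rw [vertexOfK_coDressKBmAt_eq_of_locStencil (one_le_of_neZero N) hr hK hδ hS hδs μ y, KInvStep_zero_eq, vertexOfK_KInv]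

end Road

section RoadN

variable (m : ℕ) {a : ℝ} (ha : 0 < a) {r : Fin 4 → ℕ} (hr : r ∈ box (3 + 1) (m + 1))
include hr

/-- [folklore] **… AND THE N-LEG's `ℋ_R`-PACK OF THE DRESSED STENCILS** (mod [B5] Prop. 1.2 ∧ (1.126)–(1.127) BY NAME — the road's standing `h12 ∧ h126`):
`vertexOfK G₀ (m+1) S μ y = vertexOfK (NlegRoad m a) (m+1) (coProjBmAtK (toSite r) (m+1) S) μ y` — the junction line between PART 3b's G₀-packed N families and the
`NlegRoad`-packed rows of `RestJetBlockMass` ∕ `RestKernelSandwichPacked` (§3 + `NlegKHessSplit.vertexOfK_NlegRoad_eq_vertexOf`). -/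
theorem vertexOfK_G₀_eq_vertexOfK_NlegRoad (h12 : B5.Prop12Printed (fam nOf hn1 MOf a ha)) (h126 : B5.Kernel126_127Printed (kfam nOf MOf))
    {S : Fin 4 → (Fin 4 → ℤ) → MKer 4 (Fib 3)} {Cs δs : ℝ} (hS : LocStencil S Cs δs) (hδs : 0 ≤ δs) (μ : Fin 4) (y : Fin 4 → ℤ) :
    vertexOfK (coDressKBmAt (toSite r) (m + 1) (KInvStep (d := 3) (m + 1) 0)) (m + 1) S μ y
      = vertexOfK (NlegRoad m a) (m + 1) (coProjBmAtK (toSite r) (m + 1) S) μ y := by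
  rw [vertexOfK_NlegRoad_eq_vertexOf m ha h12 h126, vertexOfK_G₀_eq_vertexOf hr hS hδs μ y]

end RoadN

/-! ## §4 Scalar-weighted words on any fibre (the ghost ∕ comb-FP families of (B6′)) -/

section Scalar

variable {N : ℕ} (hN : 1 ≤ N) {r : Fin (d + 1) → ℕ} (hr : r ∈ box (d + 1) N) {Fb : Type*}
include hN hr

/-- [folklore] **PACK BRIDGE FOR SCALAR-WEIGHTED WORDS** (any fibre `Fb`: the ghost currents, the comb gauge functions): for a decaying `K` and an entrywise-bounded
family `F : Fin (d+1) → ℤ^{d+1} → MKer (d+1) Fb`,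
`Σ_κ wsum (colH (coDressKBmAt ρ N K) N μ y κ) (F κ) x z a b = Σ_κ wsum (colH K N μ y κ) (u ↦ Πᵀ_bm F κ u) x z a b`, `(Πᵀ_bm F) κ u x z a b := coProjBmAt ρ N (F · · x z a b) κ u`. -/
theorem sum_wsum_colH_coDressKBmAt {K : MKer (d + 1) (Fib d)} {C δ : ℝ} (hK : Decays K C δ) (hδ : 0 < δ)
    (F : Fin (d + 1) → (Fin (d + 1) → ℤ) → MKer (d + 1) Fb) (x z : Fin (d + 1) → ℤ) (a b : Fb) (hFb : ∃ M : ℝ, ∀ κ u, |F κ u x z a b| ≤ M)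
    (μ : Fin (d + 1)) (y : Fin (d + 1) → ℤ) :
    (∑ κ : Fin (d + 1), wsum (colH (coDressKBmAt (toSite r) N K) N μ y κ) (F κ) x z a b)
      = ∑ κ : Fin (d + 1), wsum (colH K N μ y κ)
          (fun u => fun x z a b => coProjBmAt (toSite r) N (fun κ' u' => F κ' u' x z a b) κ u) x z a b := by
  obtain ⟨M, hM⟩ := hFb
  have hA : ∀ κ : Fin (d + 1), Summable (colH K N μ y κ) :=
    fun κ => AxialDressing.summable_col_of_decays hK hδ ((N : ℤ) • y) (Sum.inl κ) (Sum.inr μ)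
  have h := sum_tsum_mul_coProjBmAt hN hr hA (g := fun κ u => F κ u x z a b) hM
  simp only [wsum, colH_coDressKBmAt_eq]
  exact h.symm

end Scalar


/-! ## §5 Πᵀ_bm on the OUTER index through the inner vertex; the bi-vertex in FULLY DRESSED form (v1.1) -/

section Outer

open Summit.QuantumFields.BalabanUV.Beta.AxialDressingRooted (pmBm cube cWb abs_coProjBmAt_le)

variable {N : ℕ}

/-- [folklore] A `LocStencil₂` family is entrywise bounded by its constant, uniformly in both bonds. -/
theorem abs_le_of_locStencil₂ {S₂ : Fin (d + 1) → (Fin (d + 1) → ℤ) → Fin (d + 1) → (Fin (d + 1) → ℤ) → MKer (d + 1) (Fib d)} {C₂ δ₂ : ℝ}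
    (hS₂ : LocStencil₂ S₂ C₂ δ₂) (hδ₂ : 0 ≤ δ₂) (κ : Fin (d + 1)) (u : Fin (d + 1) → ℤ) (κ' : Fin (d + 1)) (u' x z : Fin (d + 1) → ℤ)
    (a b : Fib d) : |S₂ κ u κ' u' x z a b| ≤ C₂ := by
  refine (hS₂ κ u κ' u' x z a b).trans ?_
  have hC₂ := hS₂.nonneg
  have h1 : Real.exp (-δ₂ * l1 (u' - u)) ≤ 1 := Real.exp_le_one_iff.2 (by nlinarith [l1_nonneg (u' - u)])
  have h2 : Real.exp (-δ₂ * (l1 (x - u) + l1 (z - u))) ≤ 1 := Real.exp_le_one_iff.2 (by nlinarith [l1_nonneg (x - u), l1_nonneg (z - u)])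
  calc C₂ * Real.exp (-δ₂ * l1 (u' - u)) * Real.exp (-δ₂ * (l1 (x - u) + l1 (z - u)))
      ≤ C₂ * 1 * 1 := mul_le_mul (mul_le_mul_of_nonneg_left h1 hC₂) h2 (Real.exp_nonneg _) (by rw [mul_one]; exact hC₂)
    _ = C₂ := by ring

/-- [folklore] **Πᵀ_bm ON THE OUTER INDEX COMMUTES WITH THE INNER CHAIN-RULE VERTEX**: for a decaying `K` and a two-bond family `T` entrywise bounded
uniformly in both bonds, `Πᵀ_bm^{outer} (κ u ↦ vertexOfK K N (T κ u) ν y′) = (κ u ↦ vertexOfK K N (κ′ u′ ↦ Πᵀ_bm^{outer} (T · · κ′ u′) κ u) ν y′)` — the finite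
window sums pass through the absolutely convergent superposition (`tsum_mul_left`, `Summable.tsum_finsetSum`). -/
theorem coProjBmAtK_vertexOfK_comm (ρ : Fin (d + 1) → ℤ) {K : MKer (d + 1) (Fib d)} {C δ : ℝ} (hK : Decays K C δ) (hδ : 0 < δ)
    (T : Fin (d + 1) → (Fin (d + 1) → ℤ) → Fin (d + 1) → (Fin (d + 1) → ℤ) → MKer (d + 1) (Fib d))
    (hTb : ∀ x z a b, ∃ M : ℝ, ∀ κ₀ u₀ κ' u', |T κ₀ u₀ κ' u' x z a b| ≤ M) (ν : Fin (d + 1)) (y' : Fin (d + 1) → ℤ) :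
    coProjBmAtK ρ N (fun κ u => vertexOfK K N (T κ u) ν y')
      = fun κ u => vertexOfK K N (fun κ' u' => coProjBmAtK ρ N (fun κ₀ u₀ => T κ₀ u₀ κ' u') κ u) ν y' := by
  funext κ u x z a b
  obtain ⟨M, hM⟩ := hTb x z a b
  have hA : ∀ κ' : Fin (d + 1), Summable (colH K N ν y' κ') :=
    fun κ' => AxialDressing.summable_col_of_decays hK hδ ((N : ℤ) • y') (Sum.inl κ') (Sum.inr ν)
  have hs : ∀ (β : Fin (d + 1)) (w : Fin (d + 1) → ℤ) (κ' : Fin (d + 1)),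
      Summable fun u' => colH K N ν y' κ' u' * T β w κ' u' x z a b := by
    intro β w κ'
    refine Summable.of_norm_bounded (((hA κ').abs).mul_right |M|) (fun u' => ?_)
    rw [Real.norm_eq_abs, abs_mul]
    exact mul_le_mul_of_nonneg_left ((hM β w κ' u').trans (le_abs_self M)) (abs_nonneg _)
  show (∑ v ∈ cube (d + 1) N, ∑ β : Fin (d + 1), pmBm ρ N β (u + v) κ u
          * ∑ κ' : Fin (d + 1), ∑' u' : Fin (d + 1) → ℤ, colH K N ν y' κ' u' * T β (u + v) κ' u' x z a b)
      = ∑ κ' : Fin (d + 1), ∑' u' : Fin (d + 1) → ℤ, colH K N ν y' κ' u'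
          * ∑ v ∈ cube (d + 1) N, ∑ β : Fin (d + 1), pmBm ρ N β (u + v) κ u * T β (u + v) κ' u' x z a b
  have hR : ∀ κ' : Fin (d + 1), (∑' u' : Fin (d + 1) → ℤ, colH K N ν y' κ' u'
        * ∑ v ∈ cube (d + 1) N, ∑ β : Fin (d + 1), pmBm ρ N β (u + v) κ u * T β (u + v) κ' u' x z a b)
      = ∑ v ∈ cube (d + 1) N, ∑ β : Fin (d + 1), pmBm ρ N β (u + v) κ u
          * ∑' u' : Fin (d + 1) → ℤ, colH K N ν y' κ' u' * T β (u + v) κ' u' x z a b := by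
    intro κ'
    have e : ∀ u' : Fin (d + 1) → ℤ, colH K N ν y' κ' u'
          * ∑ v ∈ cube (d + 1) N, ∑ β : Fin (d + 1), pmBm ρ N β (u + v) κ u * T β (u + v) κ' u' x z a b
        = ∑ v ∈ cube (d + 1) N, ∑ β : Fin (d + 1), pmBm ρ N β (u + v) κ u * (colH K N ν y' κ' u' * T β (u + v) κ' u' x z a b) := by
      intro u'
      rw [Finset.mul_sum]
      refine Finset.sum_congr rfl fun v _ => ?_
      rw [Finset.mul_sum]
      exact Finset.sum_congr rfl fun β _ => by ring
    simp_rw [e]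
    rw [Summable.tsum_finsetSum (fun v _ => summable_sum fun β _ => (hs β (u + v) κ').mul_left _)]
    refine Finset.sum_congr rfl fun v _ => ?_
    rw [Summable.tsum_finsetSum (fun β _ => (hs β (u + v) κ').mul_left _)]
    exact Finset.sum_congr rfl fun β _ => tsum_mul_left
  simp_rw [hR]
  symm
  rw [Finset.sum_comm]
  refine Finset.sum_congr rfl fun v _ => ?_
  rw [Finset.sum_comm]
  refine Finset.sum_congr rfl fun β _ => ?_
  exact (Finset.mul_sum _ _ _).symm

variable (hN : 1 ≤ N) {r : Fin (d + 1) → ℕ} (hr : r ∈ box (d + 1) N)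
include hN hr

/-- [folklore] **THE BI-VERTEX THROUGH A Πᵀ_bm-DRESSED RESOLVENT, FULLY DRESSED FORM** (§2 + `coProjBmAtK_vertexOfK_comm`): for a decaying `K` and a `LocStencil₂` pair family,
`vertex2OfK (coDressKBmAt ρ N K) N S₂ = vertex2OfK K N S₂^{ΠΠ}`, `S₂^{ΠΠ} κ u κ′ u′ := Πᵀ_bm^{outer} (κ₀ u₀ ↦ Πᵀ_bm (S₂ κ₀ u₀) κ′ u′) κ u` — BOTH bond indices dressed,
the resolvent undressed: the shape the (S-LIT)∕(A2-N) second-order table dictionaries read. -/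
theorem vertex2OfK_coDressKBmAt_eq_full {K : MKer (d + 1) (Fib d)} {C δ : ℝ} (hK : Decays K C δ) (hC : 0 ≤ C) (hδ : 0 < δ)
    {S₂ : Fin (d + 1) → (Fin (d + 1) → ℤ) → Fin (d + 1) → (Fin (d + 1) → ℤ) → MKer (d + 1) (Fib d)} {C₂ δ₂ : ℝ}
    (hS₂ : LocStencil₂ S₂ C₂ δ₂) (hδ₂ : 0 < δ₂) (μ : Fin (d + 1)) (y : Fin (d + 1) → ℤ) (ν : Fin (d + 1)) (y' : Fin (d + 1) → ℤ) :
    vertex2OfK (coDressKBmAt (toSite r) N K) N S₂ μ y ν y'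
      = vertex2OfK K N (fun κ u κ' u' => coProjBmAtK (toSite r) N (fun κ₀ u₀ => coProjBmAtK (toSite r) N (S₂ κ₀ u₀) κ' u') κ u) μ y ν y' := by
  rw [vertex2OfK_coDressKBmAt_eq hN hr hK hC hδ hS₂ hδ₂ μ y ν y',
    coProjBmAtK_vertexOfK_comm (toSite r) hK hδ (fun κ u κ' u' => coProjBmAtK (toSite r) N (S₂ κ u) κ' u') (fun x z a b => ?_) ν y']
  · rfl
  · exact ⟨cWb d N * C₂, fun κ₀ u₀ κ' u' =>
      abs_coProjBmAt_le hN hr (fun κ₁ u₁ => S₂ κ₀ u₀ κ₁ u₁ x z a b) κ' u'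
        (fun κ₁ v _ => abs_le_of_locStencil₂ hS₂ hδ₂.le κ₀ u₀ κ₁ (u' + v) x z a b)⟩

end Outer

end Summit.QuantumFields.BalabanUV.Beta.D1BFx.PackedDressingBridge

end
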